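import Literature.Barriers.CriticalPhenomena.WeaklySAWFourDimLogCorrectionsLemmaA1
import HarnessLib

/-!
# BBS 2015, Theorem 1.2 to first order without the renormalisation group:
# `ν_c(g) = -2C₀(0) g + o(g)` (`d ≥ 3`) and `ν_c(g) < 0` (`d ≥ 1`)

Companion (theorems only; no named facts) to `WeaklySAWFourDimLogCorrections.lean` and
`WeaklySAWCriticalNuLowerBound.lean` (namespace `Literature.Barriers.CriticalPhenomena.CTWSAW`),
same source: R. Bauerschmidt, D. C. Brydges, G. Slade, *Logarithmic correction for the
susceptibility of the 4-dimensional weakly self-avoiding walk: a renormalisation group analysis*,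
CMP 337 (2015), arXiv:1403.7422.

**Theorem 1.2** of the source (`CTWSAW.BBS2015_thm12`): for `d = 4`, `ν_c(g) = -ag + O(g²)` as
`g ↓ 0`, `a = 2C₀(0)`. Its lower inequality `ν_c ≥ -ag` is the elementary Lemma A.1 (Jensen),
proved in `WeaklySAWCriticalNuLowerBound.lean`; its upper inequality with the error `O(g²)` is
obtained in §8.5 of the source from the renormalisation-group flow (Theorem 4.1, Proposition 7.1;
in the tree the named fact `CTWSAW.BBS2015_thm41_nu0c`, from which `BBS2015_thm12` follows:
`BBS2015_thm12_of_thm41_nu0c'`). This file proves, by elementary means and in every dimension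
`d ≥ 3`, the **first-order** statement

  `ν_c(d, g) = -2C₀(0) g + o(g)` (`abs_criticalNu_add_le_firstOrder`, `tendsto_criticalNu_div`;
  at `d = 4`: `BBS2015_thm12_firstOrder`, `BBS2015_thm12_tendsto`),

so that what Theorem 1.2 asserts beyond the theorems of this file is exactly the sharpening
`o(g) ↦ O(g²)`. It also proves **`ν_c(d, g) < 0` for all `d ≥ 1` and all `g > 0`**
(`criticalNu_lt_zero`; §1.3 of the source notes `ν_c(g) < 0` at `d = 4` as a consequence of
Theorem 1.2; for `g < 4d²` it also follows from `exists_neg_susceptibility_lt_top` of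
`WeaklySAWFourDimLogCorrectionsDecay.lean`), and the two remarks
of §1.3 around it: `ν_c(d, 0) = 0` (`criticalNu_zero_right`) and `ν_c(d, g) → 0` as `g ↓ 0`
(`tendsto_criticalNu_zero`, `d ≥ 3`); and the monotonicity of `ν_c(d, ·)` on `[0, ∞)`
(`criticalNu_antitoneOn`, [folklore]).

## The argument

* `criticalNu_mul_le_log_survival`: `ν_c T ≤ log c_T` for every `T > 0` — the inequality
  `c_T ≥ e^{ν_c T}` of the proof of Lemma A.1 (sub-multiplicativity, `WeaklySAWSubmultiplicativity`),
  read as an upper bound on `ν_c`; hence `ν_c ≤ (c_T - 1)/T`.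
* `survival_add_mean_le`: `c_T + gE₀I(T) ≤ 1 + g²T² E₀I(T)`, integrating
  `e^{-y} ≤ (1+y)⁻¹ ≤ 1 - y + y²` (`y = gI`) and `I ≤ T²` against the law of the trajectory
  (`trajLintegral`). Together: **`ν_c ≤ -g(1 - gT²) E₀I(T)/T`**
  (`criticalNu_le_neg_mul_meanSelfIntersection`), for every `T > 0`.
* The sharp constant needs `E₀I(T)/T → 2C₀(0)` as `T → ∞` (`tendsto_meanSelfIntersection_div`,
  `eventually_mul_le_meanSelfIntersection`; the bound `≤` is `meanSelfIntersection_le_greenSeries`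
  of `WeaklySAWCriticalNuLowerBound.lean`). This rests on the **exact layer formula**
  `Σ_{|ω|=k} ∫_{Δ_k(T)} I = 2B_k Σ_{m ≤ k} (k+1-m)(2d)^{k-m} R_m` (`B_k = T^{k+2}/(k+2)!`, `R_m` the
  closed words; `layer_selfIntersection_eq_sum_closedWords`, from the coincidence counts
  `card_coincidence` and the symmetric double sum `sum_range_sq_eq_diag_add_two_mul_upper`), a
  Tonelli rearrangement by the lag `m` (`sum_tsum_layerTerm_le`), and the Poisson-weighted series
  `e^{-x} Σ_n (n+1) x^{n+m+2}/(n+m+2)! ≥ x - (m+1)` (`hasSum_succ_mul_pow_div_factorial`: the series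
  `Σ_N (N-(m+1)) x^N/N! = (x-(m+1))eˣ` has non-positive head), giving
  `2T Σ_{m ≤ M} R_m (2d)^{-(m+1)} ≤ E₀I(T) + Σ_{m ≤ M} 2(m+1) R_m (2d)^{-(m+2)}`
  (`partialGreen_le_meanSelfIntersection_add`) for every cut-off `M`.
* `criticalNu_le_firstOrder`: given `ε`, choose `T` with `E₀I(T) ≥ (2C₀(0) - ε/2)T`, then
  `g₀ = min(1/(T²+1), ε/(4C₀(0)T² + 1))`.

Locators: Theorem 1.2, Lemma A.1 (Appendix A) and §1.3 by number; the elementary lemmas are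
[folklore].

Mathlib anchors: `Finset.sum_comm'`, `hasSum_nat_add_iff'`, `NormedSpace.expSeries_div_hasSum_exp`,
`Summable.tsum_finsetSum`, `ENNReal.tsum_comp_le_tsum_of_injective`, `ENNReal.tsum_eq_iSup_nat`,
`Real.add_one_le_exp`, `Real.log_le_sub_one_of_pos`, `Metric.tendsto_nhdsWithin_nhds`.

## References

* Bauerschmidt–Brydges–Slade 2015, Theorem 1.2, §1.3, Appendix A (Lemma A.1 and its proof).
  [BauerschmidtBrydgesSlade2015LogCorr]
-/

noncomputable section

open MeasureTheory Filter Topology Set Literature.Probability.LatticeModels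
open scoped ENNReal BigOperators Nat

namespace Literature.Barriers.CriticalPhenomena

namespace CTWSAW

variable {d : ℕ}

/-! ### `e^{ν_c T} ≤ c_T`: the critical value from above by a single time `T` -/

/-- **`e^{ν_c T} ≤ c_T`** for every `T > 0` (`d ≥ 1`, `g ≥ 0`), in real numbers: the
inequality `c_T ≥ e^{ν_c T}` of the proof of Lemma A.1 (from sub-multiplicativity
`c_{T+S} ≤ c_T c_S`: otherwise `χ(g, ν_c) < ∞`).
[cite: BauerschmidtBrydgesSlade2015LogCorr, Appendix A (proof of Lemma A.1: c_T ≥ e^{ν_c T})] -/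
theorem exp_criticalNu_mul_le_survival_toReal (hd : 0 < d) {g : ℝ} (hg : 0 ≤ g) {T : ℝ}
    (hT : 0 < T) : Real.exp (criticalNu d g * T) ≤ (survival d g T).toReal := by
  have h1 : 1 ≤ survival d g T * ENNReal.ofReal (Real.exp (-criticalNu d g * T)) := by
    by_contra h
    exact (susceptibility_lt_top_of_ratio_lt_one hg d hT (not_le.mp h)).ne
      (susceptibility_criticalNu_eq_top hd hg)
  have hfin : survival d g T ≠ ∞ :=
    (lt_of_le_of_lt (survival_le_one hg d hT) ENNReal.one_lt_top).ne
  set c := (survival d g T).toReal with hc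
  have hceq : survival d g T = ENNReal.ofReal c := (ENNReal.ofReal_toReal hfin).symm
  rw [hceq, ← ENNReal.ofReal_mul ENNReal.toReal_nonneg, ← ENNReal.ofReal_one,
    ENNReal.ofReal_le_ofReal_iff (by positivity)] at h1
  have h2 := mul_le_mul_of_nonneg_left h1 (Real.exp_pos (criticalNu d g * T)).le
  rw [mul_one, mul_left_comm, ← Real.exp_add, show criticalNu d g * T + -criticalNu d g * T = 0
    by ring, Real.exp_zero, mul_one] at h2
  exact h2

/-- **`ν_c T ≤ log c_T`** for every `T > 0` (`d ≥ 1`, `g ≥ 0`): `c_T ≥ e^{ν_c T}` read as an upper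
bound on the critical value. [cite: BauerschmidtBrydgesSlade2015LogCorr, Appendix A (proof of Lemma A.1: c_T ≥ e^{ν_c T})] -/
theorem criticalNu_mul_le_log_survival (hd : 0 < d) {g : ℝ} (hg : 0 ≤ g) {T : ℝ} (hT : 0 < T) :
    criticalNu d g * T ≤ Real.log (survival d g T).toReal :=
  have h := exp_criticalNu_mul_le_survival_toReal hd hg hT
  (Real.le_log_iff_exp_le (lt_of_lt_of_le (Real.exp_pos _) h)).2 h

/-- `ν_c ≤ (c_T - 1)/T` for every `T > 0` (`log y ≤ y - 1`). [folklore] -/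
theorem criticalNu_le_survival_sub_one_div (hd : 0 < d) {g : ℝ} (hg : 0 ≤ g) {T : ℝ} (hT : 0 < T) :
    criticalNu d g ≤ ((survival d g T).toReal - 1) / T := by
  have h := exp_criticalNu_mul_le_survival_toReal hd hg hT
  rw [le_div_iff₀ hT]
  exact (criticalNu_mul_le_log_survival hd hg hT).trans
    (Real.log_le_sub_one_of_pos (lt_of_lt_of_le (Real.exp_pos _) h))

/-! ### Second order: `c_T + g E I(T) ≤ 1 + g²T² E I(T)` -/

/-- `e^{-y} ≤ 1 - y + y²` for `y ≥ 0` (from `e^{-y} ≤ 1/(1+y)` and `1 ≤ (1+y)(1-y+y²) = 1 + y³`),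
arranged with non-negative terms. [folklore] -/
theorem exp_neg_add_le_one_add_sq {y : ℝ} (hy : 0 ≤ y) : Real.exp (-y) + y ≤ 1 + y ^ 2 := by
  have h1 : Real.exp (-y) ≤ 1 / (1 + y) := by
    rw [le_div_iff₀ (by positivity), Real.exp_neg]
    have h := Real.add_one_le_exp y
    have hpos := Real.exp_pos y
    calc (Real.exp y)⁻¹ * (1 + y) ≤ (Real.exp y)⁻¹ * Real.exp y := by
          gcongr; linarith
      _ = 1 := inv_mul_cancel₀ hpos.ne'
  have h2 : 1 / (1 + y) ≤ 1 - y + y ^ 2 := by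
    rw [div_le_iff₀ (by positivity)]
    nlinarith [pow_nonneg hy 3]
  linarith

/-- On the sojourn simplex, `I(ω, s) ≤ T²` (`I = Σ_{i,j} 𝟙{ω(i)=ω(j)} σᵢσⱼ ≤ (Σᵢ σᵢ)² = T²`).
[folklore] -/
theorem selfIntersection_le_sq {x : Site d} (ω : (zdGraph d).Walk 0 x) {T : ℝ}
    {s : Fin ω.length → ℝ} (hs : s ∈ sojournSet ω.length T) :
    selfIntersection T ω s ≤ T ^ 2 := by
  unfold selfIntersection
  calc ∑ i : Fin (ω.length + 1), ∑ j : Fin (ω.length + 1),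
        (if ω.getVert i = ω.getVert j then sojourns T s i * sojourns T s j else 0)
      ≤ ∑ i : Fin (ω.length + 1), ∑ j : Fin (ω.length + 1), sojourns T s i * sojourns T s j := by
        refine Finset.sum_le_sum fun i _ => Finset.sum_le_sum fun j _ => ?_
        split_ifs
        · exact le_rfl
        · exact mul_nonneg (sojourns_nonneg hs i) (sojourns_nonneg hs j)
    _ = (∑ i : Fin (ω.length + 1), sojourns T s i) ^ 2 := by
        rw [sq, Finset.sum_mul_sum]
    _ = T ^ 2 := by rw [sum_sojourns]

/-- **Second-order upper bound for `c_T`**: `c_{g,T} + g E₀ I(T) ≤ 1 + g²T² E₀ I(T)` (`g ≥ 0`,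
`T > 0`), integrating `e^{-gI} + gI ≤ 1 + (gI)² ≤ 1 + g²T² I` against the law of the trajectory.
[folklore] -/
theorem survival_add_mean_le {g : ℝ} (hg : 0 ≤ g) {T : ℝ} (hT : 0 < T) :
    survival d g T + ENNReal.ofReal g * meanSelfIntersection d T ≤
      1 + ENNReal.ofReal (g ^ 2 * T ^ 2) * meanSelfIntersection d T := by
  have hptw : ∀ (p : Σ x : Site d, (zdGraph d).Walk (0 : Site d) x),
      ∀ s ∈ sojournSet p.2.length T,
      ENNReal.ofReal (Real.exp (-g * selfIntersection T p.2 s)) +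
          ENNReal.ofReal g * ENNReal.ofReal (selfIntersection T p.2 s) ≤
        1 + ENNReal.ofReal (g ^ 2 * T ^ 2) * ENNReal.ofReal (selfIntersection T p.2 s) := by
    intro p s hs
    have hI := selfIntersection_nonneg p.2 hs
    have hIT := selfIntersection_le_sq p.2 hs
    rw [← ENNReal.ofReal_mul hg, ← ENNReal.ofReal_add (by positivity) (by positivity),
      ← ENNReal.ofReal_mul (by positivity), ← ENNReal.ofReal_one,
      ← ENNReal.ofReal_add zero_le_one (by positivity)]
    refine ENNReal.ofReal_le_ofReal ?_
    have h := exp_neg_add_le_one_add_sq (mul_nonneg hg hI)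
    rw [neg_mul]
    have h2 : (g * selfIntersection T p.2 s) ^ 2 ≤ g ^ 2 * T ^ 2 * selfIntersection T p.2 s := by
      rw [mul_pow, sq (selfIntersection T p.2 s), ← mul_assoc]
      exact mul_le_mul_of_nonneg_right (mul_le_mul_of_nonneg_left hIT (by positivity)) hI
    linarith
  have hint := trajLintegral_mono (d := d) (T := T) hptw
  rw [trajLintegral_add fun p =>
      (((measurable_selfIntersection T p.2).const_mul (-g)).exp).ennreal_ofReal,
    trajLintegral_add (fun p => measurable_const),
    trajLintegral_const_mul _ ENNReal.ofReal_ne_top, trajLintegral_const_mul _ ENNReal.ofReal_ne_top,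
    trajLintegral_one d hT, ← survival_eq_trajLintegral,
    ← meanSelfIntersection_eq_trajLintegral] at hint
  exact hint

/-! ### The exact layer formula `Σ_{|ω|=k} ∫ I = 2B_k Σ_{m ≤ k} (k+1-m)(2d)^{k-m} R_m` -/

/-- Symmetric double sums over `{0, …, k}²`: the diagonal plus twice the upper triangle.
[folklore] -/
theorem sum_range_sq_eq_diag_add_two_mul_upper {M : Type*} [AddCommMonoid M] (k : ℕ)
    (F : ℕ → ℕ → M) (hF : ∀ i j, F i j = F j i) :
    ∑ i ∈ Finset.range (k + 1), ∑ j ∈ Finset.range (k + 1), F i j =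
      ∑ i ∈ Finset.range (k + 1), F i i +
        2 • ∑ i ∈ Finset.range (k + 1), ∑ j ∈ Finset.Ioc i k, F i j := by
  have hsplit : ∀ i ∈ Finset.range (k + 1), ∑ j ∈ Finset.range (k + 1), F i j =
      F i i + (∑ j ∈ Finset.range i, F i j + ∑ j ∈ Finset.Ioc i k, F i j) := by
    intro i hi
    rw [← Finset.add_sum_erase _ _ hi]
    have hi' := Finset.mem_range.1 hi
    congr 1
    have h1 : (Finset.range (k + 1)).erase i = Finset.range i ∪ Finset.Ioc i k := by
      ext j
      simp only [Finset.mem_erase, Finset.mem_range, Finset.mem_union, Finset.mem_Ioc]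
      omega
    have h2 : Disjoint (Finset.range i) (Finset.Ioc i k) := by
      rw [Finset.disjoint_left]
      intro j h1 h2
      simp only [Finset.mem_range] at h1
      simp only [Finset.mem_Ioc] at h2
      omega
    rw [h1, Finset.sum_union h2]
  rw [Finset.sum_congr rfl hsplit, Finset.sum_add_distrib, Finset.sum_add_distrib, two_nsmul]
  congr 1
  congr 1
  -- the lower triangle is the upper triangle, by symmetry
  rw [Finset.sum_comm' (s := Finset.range (k + 1)) (t := fun i => Finset.range i)
    (t' := Finset.range (k + 1)) (s' := fun j => Finset.Ioc j k)
    (fun i j => by simp only [Finset.mem_range, Finset.mem_Ioc]; omega)]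
  exact Finset.sum_congr rfl fun j _ => Finset.sum_congr rfl fun i _ => hF i j

/-- `Σ_{i ≤ k} Σ_{1 ≤ m ≤ k-i} g(m) = Σ_{1 ≤ m ≤ k} (k+1-m) g(m)`. [folklore] -/
theorem sum_range_sum_Ioc_sub {M : Type*} [AddCommMonoid M] (k : ℕ) (g : ℕ → M) :
    ∑ i ∈ Finset.range (k + 1), ∑ m ∈ Finset.Ioc 0 (k - i), g m =
      ∑ m ∈ Finset.Ioc 0 k, (k + 1 - m) • g m := by
  rw [Finset.sum_comm' (s := Finset.range (k + 1)) (t := fun i => Finset.Ioc 0 (k - i))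
    (t' := Finset.Ioc 0 k) (s' := fun m => Finset.range (k + 1 - m))
    (fun i m => by simp only [Finset.mem_range, Finset.mem_Ioc]; omega)]
  refine Finset.sum_congr rfl fun m _ => ?_
  rw [Finset.sum_const, Finset.card_range]

/-- The coincidence matrix summed with the weights `1 + δ_{ij}`, in closed form:
`Σ_{i,j ≤ k} (1+δ_{ij}) #{η : ω_η(i) = ω_η(j)} = 2 Σ_{m ≤ k} (k+1-m) (2d)^{k-m} R_m`. [folklore] -/
theorem sum_weighted_coincidence_eq (k : ℕ) :
    ∑ i ∈ Finset.range (k + 1), ∑ j ∈ Finset.range (k + 1), (if i = j then 2 else 1) *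
        (Finset.univ.filter fun η : Fin k → Fin d × Bool => stepPos η i = stepPos η j).card =
      2 * ∑ m ∈ Finset.range (k + 1), (k + 1 - m) * ((2 * d) ^ (k - m) * closedWords d m) := by
  classical
  set C : ℕ → ℕ → ℕ := fun i j =>
    (Finset.univ.filter fun η : Fin k → Fin d × Bool => stepPos η i = stepPos η j).card with hC
  set g : ℕ → ℕ := fun m => (2 * d) ^ (k - m) * closedWords d m with hg
  have hCsymm : ∀ i j, C i j = C j i := fun i j => by
    simp only [hC]
    congr 1
    ext η
    simp only [Finset.mem_filter, Finset.mem_univ, true_and]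
    exact eq_comm
  have hF : ∀ i j, (if i = j then 2 else 1) * C i j = (if j = i then 2 else 1) * C j i := by
    intro i j
    rw [hCsymm i j]
    by_cases h : i = j
    · subst h; rfl
    · rw [if_neg h, if_neg (Ne.symm h)]
  change ∑ i ∈ Finset.range (k + 1), ∑ j ∈ Finset.range (k + 1), (if i = j then 2 else 1) * C i j =
    2 * ∑ m ∈ Finset.range (k + 1), (k + 1 - m) * g m
  rw [sum_range_sq_eq_diag_add_two_mul_upper k (fun i j => (if i = j then 2 else 1) * C i j) hF]
  -- the diagonal
  have hdiag : ∀ i ∈ Finset.range (k + 1), (if i = i then 2 else 1) * C i i = 2 * g 0 := by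
    intro i _
    rw [if_pos rfl]
    show 2 * (Finset.univ.filter fun η : Fin k → Fin d × Bool => stepPos η i = stepPos η i).card =
      2 * ((2 * d) ^ (k - 0) * closedWords d 0)
    rw [card_coincidence_self, Nat.sub_zero, closedWords_zero, mul_one]
  -- the upper triangle, row `i`
  have hup : ∀ i ∈ Finset.range (k + 1),
      ∑ j ∈ Finset.Ioc i k, (if i = j then 2 else 1) * C i j = ∑ m ∈ Finset.Ioc 0 (k - i), g m := by
    intro i hi
    rw [Finset.mem_range, Nat.lt_succ_iff] at hi
    have himg : (Finset.Ioc 0 (k - i)).image (fun m => i + m) = Finset.Ioc i k := by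
      ext j
      simp only [Finset.mem_image, Finset.mem_Ioc]
      constructor
      · rintro ⟨m, ⟨h1, h2⟩, rfl⟩; omega
      · intro h; exact ⟨j - i, by omega, by omega⟩
    rw [← himg, Finset.sum_image fun m _ m' _ h => by simpa using h]
    refine Finset.sum_congr rfl fun m hm => ?_
    rw [Finset.mem_Ioc] at hm
    rw [if_neg (by omega), one_mul]
    show (Finset.univ.filter fun η : Fin k → Fin d × Bool => stepPos η i = stepPos η (i + m)).card =
      (2 * d) ^ (k - m) * closedWords d m
    rw [card_coincidence (d := d) (Nat.le_add_right i m) (by omega), Nat.add_sub_cancel_left]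
  rw [Finset.sum_congr rfl hdiag, Finset.sum_congr rfl hup, sum_range_sum_Ioc_sub,
    Finset.sum_const, Finset.card_range]
  -- `Σ_{m ≤ k} = (m = 0) + Σ_{1 ≤ m ≤ k}`
  have htot : ∑ m ∈ Finset.range (k + 1), (k + 1 - m) * g m =
      (k + 1) * g 0 + ∑ m ∈ Finset.Ioc 0 k, (k + 1 - m) * g m := by
    have : Finset.range (k + 1) = insert 0 (Finset.Ioc 0 k) := by
      ext m
      simp only [Finset.mem_range, Finset.mem_insert, Finset.mem_Ioc]
      omega
    rw [this, Finset.sum_insert (by simp), Nat.sub_zero]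
  rw [htot]
  simp only [smul_eq_mul]
  rw [mul_add, Finset.mul_sum]
  congr 1
  ring

/-- **Exact layer formula.** For `T > 0` and every `k`,
`Σ_{|ω| = k} ∫_{Δ_k(T)} I(ω, s) ds = 2B_k Σ_{m ≤ k} (k+1-m)(2d)^{k-m} R_m` (`B_k = T^{k+2}/(k+2)!`,
`R_m = closedWords d m`): every pair of epochs `i, j` at lag `m = |i - j|` contributes
`(1+δ_{ij}) B_k (2d)^{k-m} R_m` (`card_coincidence`), and there are `k+1-m` ordered pairs at lag
`m ≥ 1` on each side of the diagonal. [folklore] -/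
theorem layer_selfIntersection_eq_sum_closedWords (k : ℕ) {T : ℝ} (hT : 0 < T) :
    ∑ x ∈ box d k, ∑ ω ∈ (zdGraph d).finsetWalkLength k (0 : Site d) x,
        ∫⁻ s in sojournSet ω.length T, ENNReal.ofReal (selfIntersection T ω s) =
      2 * simplexWeight T k *
        ∑ m ∈ Finset.range (k + 1), ((k + 1 - m : ℕ) : ℝ≥0∞) * ((2 * d) ^ (k - m) * closedWords d m : ℕ) := by
  classical
  rw [layer_selfIntersection_eq k hT]
  have hterm : ∀ i j : ℕ, coincidenceWeight T k i j *
      ((Finset.univ.filter fun η : Fin k → Fin d × Bool => stepPos η i = stepPos η j).card : ℝ≥0∞) =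
      simplexWeight T k * (((if i = j then 2 else 1) *
        (Finset.univ.filter fun η : Fin k → Fin d × Bool => stepPos η i = stepPos η j).card : ℕ) :
          ℝ≥0∞) := by
    intro i j
    rw [coincidenceWeight_eq]
    push_cast
    split_ifs <;> ring
  simp_rw [hterm]
  rw [Finset.sum_congr rfl fun i _ => (Finset.mul_sum _ _ _).symm, ← Finset.mul_sum]
  have h := sum_weighted_coincidence_eq (d := d) k
  have h' : (∑ i ∈ Finset.range (k + 1), ∑ j ∈ Finset.range (k + 1), (((if i = j then 2 else 1) *
      (Finset.univ.filter fun η : Fin k → Fin d × Bool => stepPos η i = stepPos η j).card : ℕ) :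
        ℝ≥0∞)) = ((2 * ∑ m ∈ Finset.range (k + 1), (k + 1 - m) * ((2 * d) ^ (k - m) *
          closedWords d m) : ℕ) : ℝ≥0∞) := by
    rw [← h]
    push_cast
    rfl
  rw [h']
  push_cast
  rw [Finset.mul_sum, Finset.mul_sum, Finset.mul_sum]
  refine Finset.sum_congr rfl fun m _ => ?_
  ring

/-! ### The Poisson-weighted series `F_m(x) = e^{-x} Σ_n (n+1) x^{m+n+2}/(m+n+2)! ≥ x - (m+1)` -/

/-- `Σ_n (n+1) x^{n+m+2}/(n+m+2)! = (x - (m+1)) eˣ + Σ_{i ≤ m+1} (m+1-i) xⁱ/i!`: the series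
`Σ_N (N - (m+1)) x^N/N! = (x - (m+1))eˣ` with its first `m+2` (non-positive) terms moved to the
right. [folklore] -/
theorem hasSum_succ_mul_pow_div_factorial (x : ℝ) (m : ℕ) :
    HasSum (fun n : ℕ => ((n : ℝ) + 1) * (x ^ (n + (m + 2)) / (n + (m + 2))!))
      ((x - (m + 1)) * Real.exp x +
        ∑ i ∈ Finset.range (m + 2), ((m : ℝ) + 1 - i) * (x ^ i / i !)) := by
  have hp : HasSum (fun n : ℕ => x ^ n / n !) (Real.exp x) := by
    rw [Real.exp_eq_exp_ℝ]
    exact NormedSpace.expSeries_div_hasSum_exp x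
  -- `Σ_N N x^N/N! = x eˣ`
  have h1' : HasSum (fun n : ℕ => (((n + 1 : ℕ) : ℝ)) * (x ^ (n + 1) / (n + 1)!)) (x * Real.exp x) := by
    have heq : (fun n : ℕ => (((n + 1 : ℕ) : ℝ)) * (x ^ (n + 1) / (n + 1)!)) =
        fun n => x * (x ^ n / n !) := by
      funext n
      rw [Nat.factorial_succ]
      push_cast
      have : ((n : ℝ) + 1) * (n ! : ℝ) ≠ 0 := by positivity
      field_simp
      ring
    rw [heq]
    exact hp.mul_left x
  have h1 : HasSum (fun n : ℕ => (n : ℝ) * (x ^ n / n !)) (x * Real.exp x) := by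
    have h := (hasSum_nat_add_iff (f := fun n : ℕ => (n : ℝ) * (x ^ n / n !)) 1).1 h1'
    simpa using h
  -- subtract `(m+1) Σ_N x^N/N!`
  have h2 : HasSum (fun n : ℕ => ((n : ℝ) - (m + 1)) * (x ^ n / n !))
      (x * Real.exp x - (m + 1) * Real.exp x) := by
    have heq : (fun n : ℕ => ((n : ℝ) - (m + 1)) * (x ^ n / n !)) =
        fun n : ℕ => (n : ℝ) * (x ^ n / n !) - ((m : ℝ) + 1) * (x ^ n / n !) := by
      funext n
      ring
    rw [heq]
    exact h1.sub (hp.mul_left ((m : ℝ) + 1))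
  -- shift by `m + 2`
  have h3 := (hasSum_nat_add_iff' (f := fun n : ℕ => ((n : ℝ) - (m + 1)) * (x ^ n / n !))
    (m + 2)).2 h2
  have hF : (fun n : ℕ => ((n : ℝ) + 1) * (x ^ (n + (m + 2)) / (n + (m + 2))!)) =
      fun n : ℕ => (((n + (m + 2) : ℕ) : ℝ) - (m + 1)) * (x ^ (n + (m + 2)) / (n + (m + 2))!) := by
    funext n
    push_cast
    ring
  have hA : (x - (m + 1)) * Real.exp x + ∑ i ∈ Finset.range (m + 2), ((m : ℝ) + 1 - i) * (x ^ i / i !) =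
      x * Real.exp x - (m + 1) * Real.exp x -
        ∑ i ∈ Finset.range (m + 2), ((i : ℝ) - (m + 1)) * (x ^ i / i !) := by
    have : ∑ i ∈ Finset.range (m + 2), ((m : ℝ) + 1 - i) * (x ^ i / i !) =
        -∑ i ∈ Finset.range (m + 2), ((i : ℝ) - (m + 1)) * (x ^ i / i !) := by
      rw [← Finset.sum_neg_distrib]
      exact Finset.sum_congr rfl fun i _ => by ring
    rw [this]
    ring
  rw [hF, hA]
  exact h3

/-- For `x ≥ 0`: the series `Σ_n (n+1) x^{n+m+2}/(n+m+2)!` is summable, with sum at least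
`(x - (m+1)) eˣ`. [folklore] -/
theorem le_tsum_succ_mul_pow_div_factorial {x : ℝ} (hx : 0 ≤ x) (m : ℕ) :
    Summable (fun n : ℕ => ((n : ℝ) + 1) * (x ^ (n + (m + 2)) / (n + (m + 2))!)) ∧
      (x - (m + 1)) * Real.exp x ≤
        ∑' n : ℕ, ((n : ℝ) + 1) * (x ^ (n + (m + 2)) / (n + (m + 2))!) := by
  have h := hasSum_succ_mul_pow_div_factorial x m
  refine ⟨h.summable, ?_⟩
  rw [h.tsum_eq]
  have hsum : 0 ≤ ∑ i ∈ Finset.range (m + 2), ((m : ℝ) + 1 - i) * (x ^ i / i !) := by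
    refine Finset.sum_nonneg fun i hi => mul_nonneg ?_ (by positivity)
    have := Finset.mem_range.1 hi
    have : (i : ℝ) ≤ m + 1 := by exact_mod_cast (by omega : i ≤ m + 1)
    linarith
  linarith

/-! ### `E₀ I(T)` from below: `2T Σ_{m ≤ M} R_m (2d)^{-(m+1)} ≤ E₀ I(T) + K_M`

In the next three lemmas `a` stands for the terms `a_T(k, m) = 2B_k (k+1-m) (2d)^{k-m} R_m` of the
exact layer formula (a bound function with its defining equation `ha`, rather than a definition). -/

/-- The layers of `E₀ I(T)` as sums of the terms `a_T(k, m) = 2B_k (k+1-m) (2d)^{k-m} R_m`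
(the exact layer formula, distributed). [folklore] -/
theorem layer_eq_sum_layerTerm {T : ℝ} (a : ℕ → ℕ → ℝ≥0∞)
    (ha : ∀ k m : ℕ, a k m =
      2 * simplexWeight T k * ((k + 1 - m : ℕ) : ℝ≥0∞) * ((2 * d) ^ (k - m) * closedWords d m : ℕ)) (k : ℕ) (hT : 0 < T) :
    ∑ x ∈ box d k, ∑ ω ∈ (zdGraph d).finsetWalkLength k (0 : Site d) x,
        ∫⁻ s in sojournSet ω.length T, ENNReal.ofReal (selfIntersection T ω s) =
      ∑ m ∈ Finset.range (k + 1), a k m := by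
  rw [layer_selfIntersection_eq_sum_closedWords k hT, Finset.mul_sum]
  refine Finset.sum_congr rfl fun m _ => ?_
  rw [ha]
  ring

/-- **Rearrangement (Tonelli, dropping the lags `m > M`).**
`Σ_{m ≤ M} Σ_n a_T(n+m, m) ≤ Σ_k Σ_{|ω|=k} ∫_{Δ_k(T)} I`. [folklore] -/
theorem sum_tsum_layerTerm_le {T : ℝ} (a : ℕ → ℕ → ℝ≥0∞)
    (ha : ∀ k m : ℕ, a k m =
      2 * simplexWeight T k * ((k + 1 - m : ℕ) : ℝ≥0∞) * ((2 * d) ^ (k - m) * closedWords d m : ℕ)) (M : ℕ) (hT : 0 < T) :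
    ∑ m ∈ Finset.range (M + 1), ∑' n : ℕ, a (n + m) m ≤
      ∑' k : ℕ, ∑ x ∈ box d k, ∑ ω ∈ (zdGraph d).finsetWalkLength k (0 : Site d) x,
        ∫⁻ s in sojournSet ω.length T, ENNReal.ofReal (selfIntersection T ω s) := by
  simp_rw [layer_eq_sum_layerTerm a ha _ hT]
  calc ∑ m ∈ Finset.range (M + 1), ∑' n : ℕ, a (n + m) m
      ≤ ∑ m ∈ Finset.range (M + 1), ∑' k : ℕ, (if m ≤ k then a k m else 0) := by
        refine Finset.sum_le_sum fun m _ => ?_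
        have h := ENNReal.tsum_comp_le_tsum_of_injective (add_left_injective m)
          (fun k => if m ≤ k then a k m else 0)
        refine le_trans (le_of_eq (tsum_congr fun n => ?_)) h
        simp only [if_pos (Nat.le_add_left m n)]
    _ = ∑' k : ℕ, ∑ m ∈ Finset.range (M + 1), (if m ≤ k then a k m else 0) :=
        (Summable.tsum_finsetSum fun _ _ => ENNReal.summable).symm
    _ ≤ ∑' k : ℕ, ∑ m ∈ Finset.range (k + 1), a k m := by
        refine ENNReal.tsum_le_tsum fun k => ?_
        rw [← Finset.sum_filter]
        refine Finset.sum_le_sum_of_subset fun m hm => ?_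
        simp only [Finset.mem_filter, Finset.mem_range] at hm ⊢
        omega

/-- **The lag-`m` contribution, evaluated.** With `x = 2dT`,
`e^{-2dT} Σ_n a_T(n+m, m) = R_m · 2(2d)^{-(m+2)} F_m(x)`, `F_m(x) = e^{-x}Σ_n (n+1)x^{n+m+2}/(n+m+2)!
≥ x - (m+1)`, whence `R_m · 2T(2d)^{-(m+1)} ≤ e^{-2dT} Σ_n a_T(n+m, m) + R_m · 2(m+1)(2d)^{-(m+2)}`.
[folklore] -/
theorem closedWords_mul_le_exp_mul_tsum_layerTerm_add (hd : 0 < d) {T : ℝ} (hT : 0 < T) (a : ℕ → ℕ → ℝ≥0∞)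
    (ha : ∀ k m : ℕ, a k m =
      2 * simplexWeight T k * ((k + 1 - m : ℕ) : ℝ≥0∞) * ((2 * d) ^ (k - m) * closedWords d m : ℕ)) (m : ℕ) :
    (closedWords d m : ℝ≥0∞) * ENNReal.ofReal (2 * T * ((2 * d : ℝ)⁻¹) ^ (m + 1)) ≤
      ENNReal.ofReal (Real.exp (-(2 * d) * T)) * ∑' n : ℕ, a (n + m) m +
        (closedWords d m : ℝ≥0∞) * ENNReal.ofReal (2 * (m + 1) * ((2 * d : ℝ)⁻¹) ^ (m + 2)) := by
  have hD : (0 : ℝ) < 2 * d := by positivity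
  have hx : (0 : ℝ) ≤ 2 * d * T := by positivity
  obtain ⟨hsum, hle⟩ := le_tsum_succ_mul_pow_div_factorial hx m
  -- the real terms `t n` with `a_T(n+m, m) = R_m · ofReal (t n)`
  have ht0 : ∀ n : ℕ, 0 ≤ 2 * ((2 * d : ℝ)⁻¹) ^ (m + 2) *
      (((n : ℝ) + 1) * ((2 * d * T) ^ (n + (m + 2)) / (n + (m + 2))!)) := fun n => by positivity
  have hterm : ∀ n : ℕ, a (n + m) m = (closedWords d m : ℝ≥0∞) *
      ENNReal.ofReal (2 * ((2 * d : ℝ)⁻¹) ^ (m + 2) *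
        (((n : ℝ) + 1) * ((2 * d * T) ^ (n + (m + 2)) / (n + (m + 2))!))) := by
    intro n
    rw [ha]
    unfold simplexWeight
    have e1 : ((n + m + 1 - m : ℕ) : ℝ≥0∞) = ENNReal.ofReal ((n : ℝ) + 1) := by
      rw [show n + m + 1 - m = n + 1 by omega, ← ENNReal.ofReal_natCast]
      push_cast
      rfl
    have e2 : (((2 * d) ^ (n + m - m) * closedWords d m : ℕ) : ℝ≥0∞) =
        ENNReal.ofReal ((2 * d : ℝ) ^ n) * (closedWords d m : ℝ≥0∞) := by
      rw [show n + m - m = n by omega]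
      push_cast
      rw [two_mul_natCast_eq_ofReal, ← ENNReal.ofReal_pow hD.le]
    have e3 : (2 : ℝ≥0∞) = ENNReal.ofReal 2 := by rw [ENNReal.ofReal_ofNat]
    rw [e1, e2, e3]
    calc ENNReal.ofReal 2 * ENNReal.ofReal (T ^ (n + m + 2) / (n + m + 2)!) * ENNReal.ofReal ((n : ℝ) + 1) *
          (ENNReal.ofReal ((2 * d : ℝ) ^ n) * (closedWords d m : ℝ≥0∞))
        = (closedWords d m : ℝ≥0∞) * (ENNReal.ofReal 2 * ENNReal.ofReal (T ^ (n + m + 2) / (n + m + 2)!) *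
            ENNReal.ofReal ((n : ℝ) + 1) * ENNReal.ofReal ((2 * d : ℝ) ^ n)) := by ring
      _ = (closedWords d m : ℝ≥0∞) * ENNReal.ofReal (2 * (T ^ (n + m + 2) / (n + m + 2)!) *
            ((n : ℝ) + 1) * (2 * d : ℝ) ^ n) := by
          rw [ENNReal.ofReal_mul (by positivity), ENNReal.ofReal_mul (by positivity),
            ENNReal.ofReal_mul (by positivity)]
      _ = _ := by
          congr 1
          congr 1
          rw [show n + (m + 2) = n + m + 2 by omega]
          have hf : ((n + m + 2)! : ℝ) ≠ 0 := by positivity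
          rw [mul_pow, inv_pow]
          field_simp
          ring
  -- sum the terms
  have htsum : ∑' n : ℕ, a (n + m) m = (closedWords d m : ℝ≥0∞) *
      ENNReal.ofReal (∑' n : ℕ, 2 * ((2 * d : ℝ)⁻¹) ^ (m + 2) *
        (((n : ℝ) + 1) * ((2 * d * T) ^ (n + (m + 2)) / (n + (m + 2))!))) := by
    simp_rw [hterm]
    rw [ENNReal.tsum_mul_left, ← ENNReal.ofReal_tsum_of_nonneg ht0 (hsum.mul_left _)]
  rw [htsum, tsum_mul_left, mul_left_comm, ← ENNReal.ofReal_mul (Real.exp_pos _).le, ← mul_add,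
    ← ENNReal.ofReal_add (mul_nonneg (Real.exp_pos _).le (mul_nonneg (by positivity) (tsum_nonneg
      fun n => by positivity))) (by positivity)]
  refine mul_le_mul' le_rfl (ENNReal.ofReal_le_ofReal ?_)
  -- the real inequality
  set S := ∑' n : ℕ, ((n : ℝ) + 1) * ((2 * d * T) ^ (n + (m + 2)) / (n + (m + 2))!) with hS
  have hexp : Real.exp (-(2 * d) * T) * Real.exp (2 * d * T) = 1 := by
    rw [← Real.exp_add, show -(2 * d) * T + 2 * d * T = 0 by ring, Real.exp_zero]
  have key : Real.exp (-(2 * d) * T) * (2 * ((2 * d : ℝ)⁻¹) ^ (m + 2) * ((2 * d * T - (m + 1)) *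
      Real.exp (2 * d * T))) ≤
      Real.exp (-(2 * d) * T) * (2 * ((2 * d : ℝ)⁻¹) ^ (m + 2) * S) :=
    mul_le_mul_of_nonneg_left (mul_le_mul_of_nonneg_left hle (by positivity)) (Real.exp_pos _).le
  have hid : Real.exp (-(2 * d) * T) * (2 * ((2 * d : ℝ)⁻¹) ^ (m + 2) * ((2 * d * T - (m + 1)) *
      Real.exp (2 * d * T))) = 2 * T * ((2 * d : ℝ)⁻¹) ^ (m + 1) - 2 * (m + 1) * ((2 * d : ℝ)⁻¹) ^ (m + 2) := by
    calc _ = (Real.exp (-(2 * d) * T) * Real.exp (2 * d * T)) * (2 * ((2 * d : ℝ)⁻¹) ^ (m + 2) *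
          (2 * d * T - (m + 1))) := by ring
      _ = _ := by
          rw [hexp, one_mul]
          have hD' : (2 * d : ℝ) ≠ 0 := hD.ne'
          rw [inv_pow, inv_pow]
          field_simp
          ring
  linarith [key, hid]

/-- **`E₀ I(T)` from below.** For `d > 0`, `T > 0` and every cut-off `M`:
`2T Σ_{m ≤ M} R_m (2d)^{-(m+1)} ≤ E₀ I(T) + Σ_{m ≤ M} 2(m+1) R_m (2d)^{-(m+2)}`; together with
`E₀ I(T) ≤ 2T Σ_m R_m (2d)^{-(m+1)}` (`meanSelfIntersection_le_greenSeries`) this says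
`E₀ I(T)/T → 2C₀(0)` as `T → ∞` whenever the Green function is finite. [folklore] -/
theorem partialGreen_le_meanSelfIntersection_add (hd : 0 < d) (M : ℕ) {T : ℝ} (hT : 0 < T) :
    2 * ENNReal.ofReal T * ∑ m ∈ Finset.range (M + 1), (closedWords d m : ℝ≥0∞) * (2 * d : ℝ≥0∞)⁻¹ ^ (m + 1) ≤
      meanSelfIntersection d T + ∑ m ∈ Finset.range (M + 1),
        (closedWords d m : ℝ≥0∞) * ENNReal.ofReal (2 * (m + 1) * ((2 * d : ℝ)⁻¹) ^ (m + 2)) := by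
  have hE : meanSelfIntersection d T = ENNReal.ofReal (Real.exp (-(2 * d) * T)) *
      ∑' k : ℕ, ∑ x ∈ box d k, ∑ ω ∈ (zdGraph d).finsetWalkLength k (0 : Site d) x,
        ∫⁻ s in sojournSet ω.length T, ENNReal.ofReal (selfIntersection T ω s) := rfl
  set a : ℕ → ℕ → ℝ≥0∞ := fun k m =>
    2 * simplexWeight T k * ((k + 1 - m : ℕ) : ℝ≥0∞) * ((2 * d) ^ (k - m) * closedWords d m : ℕ)
  have ha : ∀ k m : ℕ, a k m =
      2 * simplexWeight T k * ((k + 1 - m : ℕ) : ℝ≥0∞) * ((2 * d) ^ (k - m) * closedWords d m : ℕ) :=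
    fun _ _ => rfl
  calc 2 * ENNReal.ofReal T * ∑ m ∈ Finset.range (M + 1), (closedWords d m : ℝ≥0∞) * (2 * d : ℝ≥0∞)⁻¹ ^ (m + 1)
      = ∑ m ∈ Finset.range (M + 1), (closedWords d m : ℝ≥0∞) *
          ENNReal.ofReal (2 * T * ((2 * d : ℝ)⁻¹) ^ (m + 1)) := by
        rw [Finset.mul_sum]
        refine Finset.sum_congr rfl fun m _ => ?_
        rw [inv_two_mul_pow_eq_ofReal hd, ENNReal.ofReal_mul (by positivity), ENNReal.ofReal_mul zero_le_two,
          ENNReal.ofReal_ofNat]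
        ring
    _ ≤ ∑ m ∈ Finset.range (M + 1), (ENNReal.ofReal (Real.exp (-(2 * d) * T)) *
          ∑' n : ℕ, a (n + m) m +
        (closedWords d m : ℝ≥0∞) * ENNReal.ofReal (2 * (m + 1) * ((2 * d : ℝ)⁻¹) ^ (m + 2))) :=
        Finset.sum_le_sum fun m _ => closedWords_mul_le_exp_mul_tsum_layerTerm_add hd hT a ha m
    _ = ENNReal.ofReal (Real.exp (-(2 * d) * T)) *
          ∑ m ∈ Finset.range (M + 1), ∑' n : ℕ, a (n + m) m +
        ∑ m ∈ Finset.range (M + 1),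
          (closedWords d m : ℝ≥0∞) * ENNReal.ofReal (2 * (m + 1) * ((2 * d : ℝ)⁻¹) ^ (m + 2)) := by
        rw [Finset.sum_add_distrib, Finset.mul_sum]
    _ ≤ _ := by
        rw [hE]
        gcongr
        exact sum_tsum_layerTerm_le a ha M hT

/-! ### Elementary bounds on `E₀ I(T)`: `e^{-2dT} T² ≤ E₀ I(T) ≤ T²` -/

/-- `E₀ I(T) ≤ T²` (`I ≤ T²` pointwise; any `d`, `T > 0`). [folklore] -/
theorem meanSelfIntersection_le_sq (d : ℕ) {T : ℝ} (hT : 0 < T) :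
    meanSelfIntersection d T ≤ ENNReal.ofReal (T ^ 2) := by
  have h := trajLintegral_mono (d := d) (T := T)
    (F := fun p s => ENNReal.ofReal (selfIntersection T p.2 s)) (G := fun _ _ => ENNReal.ofReal (T ^ 2) * 1)
    fun p s hs => by rw [mul_one]; exact ENNReal.ofReal_le_ofReal (selfIntersection_le_sq p.2 hs)
  rwa [trajLintegral_const_mul _ ENNReal.ofReal_ne_top, trajLintegral_one d hT, mul_one,
    ← meanSelfIntersection_eq_trajLintegral] at h

/-- `e^{-2dT} T² ≤ E₀ I(T)` (the trajectory that never jumps has `I = T²`; any `d`, `T > 0`), so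
`E₀ I(T) > 0`. [folklore] -/
theorem exp_mul_sq_le_meanSelfIntersection (d : ℕ) {T : ℝ} (hT : 0 < T) :
    ENNReal.ofReal (Real.exp (-(2 * d) * T) * T ^ 2) ≤ meanSelfIntersection d T := by
  have hE : meanSelfIntersection d T = ENNReal.ofReal (Real.exp (-(2 * d) * T)) *
      ∑' k : ℕ, ∑ x ∈ box d k, ∑ ω ∈ (zdGraph d).finsetWalkLength k (0 : Site d) x,
        ∫⁻ s in sojournSet ω.length T, ENNReal.ofReal (selfIntersection T ω s) := rfl
  have h0 : ∑ x ∈ box d 0, ∑ ω ∈ (zdGraph d).finsetWalkLength 0 (0 : Site d) x,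
        ∫⁻ s in sojournSet ω.length T, ENNReal.ofReal (selfIntersection T ω s) = ENNReal.ofReal (T ^ 2) := by
    rw [layer_selfIntersection_eq_sum_closedWords 0 hT, Finset.sum_range_one]
    unfold simplexWeight
    simp only [Nat.sub_zero, pow_zero, closedWords_zero, Nat.cast_one, mul_one, zero_add]
    rw [show (2 : ℝ≥0∞) = ENNReal.ofReal 2 by rw [ENNReal.ofReal_ofNat], ← ENNReal.ofReal_mul zero_le_two]
    congr 1
    have h2 : ((0 + 2)! : ℝ) = 2 := by norm_num [Nat.factorial]
    rw [h2]
    ring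
  rw [hE, ENNReal.ofReal_mul (Real.exp_pos _).le, ← h0]
  exact mul_le_mul' le_rfl (ENNReal.le_tsum 0)

/-! ### `ν_c ≤ -g (1 - gT²) E₀ I(T)/T`: an explicit upper bound on the critical value -/

/-- **Explicit upper bound on the critical value.** For `d ≥ 1`, `g > 0`, `T > 0`:
`ν_c(d, g) ≤ -g(1 - gT²) · E₀ I(T)/T` (from `ν_c T ≤ log c_T ≤ c_T - 1` and the second-order bound
`c_T ≤ 1 - gE₀ I(T) + g²T² E₀ I(T)`). [folklore] -/
theorem criticalNu_le_neg_mul_meanSelfIntersection (hd : 0 < d) {g : ℝ} (hg : 0 < g) {T : ℝ} (hT : 0 < T) :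
    criticalNu d g ≤ -(g * (1 - g * T ^ 2)) * (meanSelfIntersection d T).toReal / T := by
  have hmfin : meanSelfIntersection d T ≠ ∞ :=
    (lt_of_le_of_lt (meanSelfIntersection_le_sq d hT) ENNReal.ofReal_lt_top).ne
  have hcfin : survival d g T ≠ ∞ :=
    (lt_of_le_of_lt (survival_le_one hg.le d hT) ENNReal.one_lt_top).ne
  have h1 := criticalNu_le_survival_sub_one_div hd hg.le hT
  have h2 := survival_add_mean_le (d := d) hg.le hT
  set μ := (meanSelfIntersection d T).toReal with hμ
  have hμ0 : 0 ≤ μ := ENNReal.toReal_nonneg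
  have hmeq : meanSelfIntersection d T = ENNReal.ofReal μ := (ENNReal.ofReal_toReal hmfin).symm
  set c := (survival d g T).toReal with hc
  have hc0 : 0 ≤ c := ENNReal.toReal_nonneg
  have hceq : survival d g T = ENNReal.ofReal c := (ENNReal.ofReal_toReal hcfin).symm
  rw [hmeq, hceq, ← ENNReal.ofReal_mul hg.le, ← ENNReal.ofReal_mul (by positivity),
    ← ENNReal.ofReal_add hc0 (by positivity), ← ENNReal.ofReal_one,
    ← ENNReal.ofReal_add zero_le_one (by positivity),
    ENNReal.ofReal_le_ofReal_iff (by positivity)] at h2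
  -- `h2 : c + g μ ≤ 1 + g²T² μ`
  calc criticalNu d g ≤ (c - 1) / T := h1
    _ ≤ -(g * (1 - g * T ^ 2)) * μ / T := by
        refine div_le_div_of_nonneg_right ?_ hT.le
        nlinarith [h2]

/-- **`ν_c(d, g) < 0` for every `d ≥ 1` and every `g > 0`** ("`ν_c(g) < 0` for `g > 0`", stated
in §1.3 of the source as a consequence of Theorem 1.2 at `d = 4`; here elementary and in all
dimensions). [cite: BauerschmidtBrydgesSlade2015LogCorr, §1.3 (first paragraph)] -/
theorem criticalNu_lt_zero (hd : 0 < d) {g : ℝ} (hg : 0 < g) : criticalNu d g < 0 := by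
  set T : ℝ := 1 / (g + 1) with hT
  have hT0 : 0 < T := by positivity
  have hT1 : T ≤ 1 := by rw [hT, div_le_one (by positivity)]; linarith
  have hgT : g * T ^ 2 < 1 := by
    have h1 : g * T < 1 := by
      rw [hT, mul_one_div, div_lt_one (by positivity)]; linarith
    calc g * T ^ 2 = g * T * T := by ring
      _ ≤ g * T * 1 := by gcongr
      _ < 1 := by rw [mul_one]; exact h1
  have hμpos : 0 < (meanSelfIntersection d T).toReal := by
    refine ENNReal.toReal_pos (ne_of_gt (lt_of_lt_of_le ?_ (exp_mul_sq_le_meanSelfIntersection d hT0)))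
      (lt_of_le_of_lt (meanSelfIntersection_le_sq d hT0) ENNReal.ofReal_lt_top).ne
    exact ENNReal.ofReal_pos.2 (by positivity)
  calc criticalNu d g ≤ -(g * (1 - g * T ^ 2)) * (meanSelfIntersection d T).toReal / T :=
        criticalNu_le_neg_mul_meanSelfIntersection hd hg hT0
    _ < 0 := by
        refine div_neg_of_neg_of_pos ?_ hT0
        have : 0 < g * (1 - g * T ^ 2) * (meanSelfIntersection d T).toReal :=
          mul_pos (mul_pos hg (by linarith)) hμpos
        linarith

/-! ### `sup_T E₀ I(T)/T = 2C₀(0)`: the sharp constant -/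

/-- `E₀ I(T) ≤ 2C₀(0) T` in real numbers (finite Green function; `meanSelfIntersection_le_greenSeries`).
[cite: BauerschmidtBrydgesSlade2015LogCorr, Lemma A.1 (proof: E(I(T)) ≤ 2TC₀(0))] -/
theorem toReal_meanSelfIntersection_le (hG : greenSeries d ≠ ∞) {T : ℝ} (hT : 0 < T) :
    (meanSelfIntersection d T).toReal ≤ 2 * greenZero d * T := by
  have hd := pos_of_greenSeries_ne_top hG
  have hGZ : greenZero d = (greenSeries d).toReal := by
    rw [greenZero_eq_toReal, greenLintegral_eq_greenSeries hd]
  have h := meanSelfIntersection_le_greenSeries d hT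
  have h' := ENNReal.toReal_mono
    (ENNReal.mul_ne_top (ENNReal.mul_ne_top (by simp) ENNReal.ofReal_ne_top) hG) h
  rw [ENNReal.toReal_mul, ENNReal.toReal_mul, ENNReal.toReal_ofReal hT.le, ← hGZ] at h'
  simpa [mul_comm, mul_assoc, mul_left_comm] using h'

/-- For every `a < 2C₀(0)`, `E₀ I(T) ≥ aT` for all large `T` (finite Green function): choose the
cut-off `M` with `2 Σ_{m ≤ M} R_m (2d)^{-(m+1)} > a`, then `T` large in
`partialGreen_le_meanSelfIntersection_add`. [folklore] -/
theorem eventually_mul_le_meanSelfIntersection (hG : greenSeries d ≠ ∞) {a : ℝ} (ha : a < 2 * greenZero d) :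
    ∃ T₀ : ℝ, 0 < T₀ ∧ ∀ T : ℝ, T₀ ≤ T → ENNReal.ofReal (a * T) ≤ meanSelfIntersection d T := by
  have hd := pos_of_greenSeries_ne_top hG
  rcases lt_or_ge a 0 with ha0 | ha0
  · refine ⟨1, one_pos, fun T hT => ?_⟩
    rw [ENNReal.ofReal_of_nonpos (by nlinarith)]
    exact bot_le
  have hGZ : greenZero d = (greenSeries d).toReal := by
    rw [greenZero_eq_toReal, greenLintegral_eq_greenSeries hd]
  set f : ℕ → ℝ≥0∞ := fun m => (closedWords d m : ℝ≥0∞) * (2 * d : ℝ≥0∞)⁻¹ ^ (m + 1) with hf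
  -- a cut-off `M` capturing more than `a/2` of the Green series
  have hlt : ENNReal.ofReal (a / 2) < ∑' m, f m := by
    rw [show ∑' m, f m = greenSeries d from rfl, ENNReal.ofReal_lt_iff_lt_toReal (by positivity) hG]
    linarith
  rw [ENNReal.tsum_eq_iSup_nat] at hlt
  obtain ⟨M, hM⟩ := lt_iSup_iff.1 hlt
  have hM' : ENNReal.ofReal (a / 2) < ∑ m ∈ Finset.range (M + 1), f m :=
    lt_of_lt_of_le hM (Finset.sum_le_sum_of_subset (Finset.range_subset_range.2 (Nat.le_succ M)))
  set P := ∑ m ∈ Finset.range (M + 1), f m with hP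
  have hPfin : P ≠ ∞ := by
    refine (lt_of_le_of_lt ?_ (lt_top_iff_ne_top.2 hG)).ne
    exact ENNReal.sum_le_tsum _
  set γ := P.toReal with hγ
  have hPeq : P = ENNReal.ofReal γ := (ENNReal.ofReal_toReal hPfin).symm
  have haγ : a / 2 < γ := (ENNReal.ofReal_lt_iff_lt_toReal (by positivity) hPfin).1 hM'
  set K := ∑ m ∈ Finset.range (M + 1),
    (closedWords d m : ℝ≥0∞) * ENNReal.ofReal (2 * (m + 1) * ((2 * d : ℝ)⁻¹) ^ (m + 2)) with hK
  have hKfin : K ≠ ∞ := by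
    refine ENNReal.sum_ne_top.2 fun m _ => ENNReal.mul_ne_top (ENNReal.natCast_ne_top _) ENNReal.ofReal_ne_top
  set κ := K.toReal with hκ
  have hκ0 : 0 ≤ κ := ENNReal.toReal_nonneg
  have hKeq : K = ENNReal.ofReal κ := (ENNReal.ofReal_toReal hKfin).symm
  -- the threshold time
  set T₀ : ℝ := κ / (2 * γ - a) + 1 with hT₀
  have hden : 0 < 2 * γ - a := by linarith
  have hT₀0 : 0 < T₀ := by positivity
  refine ⟨T₀, hT₀0, fun T hT => ?_⟩
  have hT0 : 0 < T := lt_of_lt_of_le hT₀0 hT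
  have hmain := partialGreen_le_meanSelfIntersection_add hd M hT0
  rw [← hP, ← hK, hPeq, hKeq] at hmain
  -- `2Tγ ≥ aT + κ`
  have hreal : a * T + κ ≤ 2 * T * γ := by
    have h1 : (2 * γ - a) * T₀ = κ + (2 * γ - a) := by
      rw [hT₀]; field_simp
    have h2 : (2 * γ - a) * T₀ ≤ (2 * γ - a) * T := mul_le_mul_of_nonneg_left hT hden.le
    nlinarith
  have h2 : ENNReal.ofReal (a * T) + ENNReal.ofReal κ ≤ meanSelfIntersection d T + ENNReal.ofReal κ := by
    calc ENNReal.ofReal (a * T) + ENNReal.ofReal κ = ENNReal.ofReal (a * T + κ) :=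
          (ENNReal.ofReal_add (by positivity) hκ0).symm
      _ ≤ ENNReal.ofReal (2 * T * γ) := ENNReal.ofReal_le_ofReal hreal
      _ = 2 * ENNReal.ofReal T * ENNReal.ofReal γ := by
          rw [ENNReal.ofReal_mul (by positivity), ENNReal.ofReal_mul zero_le_two, ENNReal.ofReal_ofNat]
      _ ≤ _ := hmain
  exact (ENNReal.add_le_add_iff_right ENNReal.ofReal_ne_top).1 h2

/-- For every `a < 2C₀(0)` there is a time `T > 0` with `E₀ I(T) ≥ aT` (finite Green function).
[folklore] -/
theorem exists_mul_le_meanSelfIntersection (hG : greenSeries d ≠ ∞) {a : ℝ} (ha : a < 2 * greenZero d) :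
    ∃ T : ℝ, 0 < T ∧ ENNReal.ofReal (a * T) ≤ meanSelfIntersection d T := by
  obtain ⟨T₀, hT₀, h⟩ := eventually_mul_le_meanSelfIntersection hG ha
  exact ⟨T₀, hT₀, h T₀ le_rfl⟩

/-- **`E₀ I(T) ∼ 2C₀(0) T` as `T → ∞`** (finite Green function, e.g. `d ≥ 3`): the mean
self-intersection local time per unit time tends to `a = 2C₀(0)`, the sharp constant of Lemma A.1
and Theorem 1.2. [folklore] -/
theorem tendsto_meanSelfIntersection_div (hG : greenSeries d ≠ ∞) :
    Tendsto (fun T : ℝ => (meanSelfIntersection d T).toReal / T) atTop (𝓝 (2 * greenZero d)) := by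
  rw [tendsto_order]
  refine ⟨fun a' ha' => ?_, fun b hb => ?_⟩
  · obtain ⟨a, ha'a, ha⟩ := exists_between ha'
    obtain ⟨T₀, hT₀, h⟩ := eventually_mul_le_meanSelfIntersection hG ha
    filter_upwards [eventually_ge_atTop T₀] with T hT
    have hTpos : 0 < T := lt_of_lt_of_le hT₀ hT
    have hfin : meanSelfIntersection d T ≠ ∞ :=
      (lt_of_le_of_lt (meanSelfIntersection_le_sq d hTpos) ENNReal.ofReal_lt_top).ne
    have h1 : a * T ≤ (meanSelfIntersection d T).toReal := by
      rcases le_or_gt 0 (a * T) with h0 | h0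
      · exact (ENNReal.ofReal_le_iff_le_toReal hfin).1 (h T hT)
      · exact le_trans h0.le ENNReal.toReal_nonneg
    calc a' < a := ha'a
      _ ≤ (meanSelfIntersection d T).toReal / T := by rw [le_div_iff₀ hTpos]; exact h1
  · filter_upwards [eventually_gt_atTop 0] with T hT
    refine lt_of_le_of_lt ?_ hb
    rw [div_le_iff₀ hT]
    exact toReal_meanSelfIntersection_le hG hT

/-! ### Theorem 1.2 to first order, without the renormalisation group -/

/-- **Upper bound to first order**: for `d ≥ 3` and every `ε > 0` there is `g₀ > 0` with
`ν_c(d, g) ≤ -(2C₀(0) - ε) g` for all `g ∈ (0, g₀)`. [folklore] -/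
theorem criticalNu_le_firstOrder (hd : 3 ≤ d) {ε : ℝ} (hε : 0 < ε) :
    ∃ g₀ : ℝ, 0 < g₀ ∧ ∀ g : ℝ, 0 < g → g < g₀ →
      criticalNu d g ≤ -(2 * greenZero d - ε) * g := by
  have hd0 : 0 < d := by omega
  have hG : greenSeries d ≠ ∞ := (greenSeries_lt_top hd).ne
  have hG0 : 0 < greenZero d := greenZero_pos hd
  obtain ⟨T, hT, hm⟩ := exists_mul_le_meanSelfIntersection hG (a := 2 * greenZero d - ε / 2) (by linarith)
  have hmfin : meanSelfIntersection d T ≠ ∞ :=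
    (lt_of_le_of_lt (meanSelfIntersection_le_sq d hT) ENNReal.ofReal_lt_top).ne
  set μ := (meanSelfIntersection d T).toReal with hμ
  have hμlow : (2 * greenZero d - ε / 2) * T ≤ μ := by
    rcases le_or_gt 0 ((2 * greenZero d - ε / 2) * T) with h0 | h0
    · exact (ENNReal.ofReal_le_iff_le_toReal hmfin).1 hm
    · exact le_trans h0.le ENNReal.toReal_nonneg
  have hμup : μ ≤ 2 * greenZero d * T := toReal_meanSelfIntersection_le hG hT
  refine ⟨min (1 / (T ^ 2 + 1)) (ε / (4 * greenZero d * T ^ 2 + 1)), by positivity, fun g hg hgg₀ => ?_⟩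
  have hg1 : g < 1 / (T ^ 2 + 1) := lt_of_lt_of_le hgg₀ (min_le_left _ _)
  have hg2 : g < ε / (4 * greenZero d * T ^ 2 + 1) := lt_of_lt_of_le hgg₀ (min_le_right _ _)
  have hgT : g * T ^ 2 < 1 := by
    rw [lt_div_iff₀ (by positivity)] at hg1; nlinarith
  have hgε : 4 * greenZero d * T ^ 2 * g < ε := by
    rw [lt_div_iff₀ (by positivity)] at hg2; nlinarith
  have h := criticalNu_le_neg_mul_meanSelfIntersection hd0 hg hT
  rw [← hμ] at h
  -- `ν_c ≤ -g(1-gT²) μ/T ≤ -g(1-gT²)(2C₀ - ε/2) ≤ -(2C₀ - ε) g`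
  have hfac : 0 ≤ g * (1 - g * T ^ 2) := mul_nonneg hg.le (by linarith)
  calc criticalNu d g ≤ -(g * (1 - g * T ^ 2)) * μ / T := h
    _ ≤ -(g * (1 - g * T ^ 2)) * ((2 * greenZero d - ε / 2) * T) / T := by
        refine div_le_div_of_nonneg_right ?_ hT.le
        nlinarith [hμlow, hfac]
    _ = -(g * (1 - g * T ^ 2)) * (2 * greenZero d - ε / 2) := by
        field_simp
    _ ≤ -(2 * greenZero d - ε) * g := by
        have e : -(g * (1 - g * T ^ 2)) * (2 * greenZero d - ε / 2) =
            -(2 * greenZero d - ε) * g - g * ε / 2 + g * (4 * greenZero d * T ^ 2 * g) / 2 -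
              g ^ 2 * T ^ 2 * ε / 2 := by ring
        have h3 : g * (4 * greenZero d * T ^ 2 * g) < g * ε := mul_lt_mul_of_pos_left hgε hg
        have h4 : 0 ≤ g ^ 2 * T ^ 2 * ε := by positivity
        rw [e]
        linarith

/-- **Theorem 1.2 of Bauerschmidt–Brydges–Slade 2015 to first order, proved without the
renormalisation group, in every dimension `d ≥ 3`**: for every `ε > 0` there is `g₀ > 0` such that
`|ν_c(d, g) + 2C₀(0) g| ≤ ε g` for all `g ∈ (0, g₀)`, i.e. `ν_c(g) = -ag + o(g)` with `a = 2C₀(0)`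
(the lower inequality `ν_c ≥ -ag` is Lemma A.1; the upper one is
`criticalNu_le_firstOrder`). The content of Theorem 1.2 (`BBS2015_thm12`) beyond this statement is
the sharpening `o(g) ↦ O(g²)` at `d = 4`, which is where the renormalisation-group analysis enters.
[cite: BauerschmidtBrydgesSlade2015LogCorr, Theorem 1.2 and Lemma A.1] -/
theorem abs_criticalNu_add_le_firstOrder (hd : 3 ≤ d) {ε : ℝ} (hε : 0 < ε) :
    ∃ g₀ : ℝ, 0 < g₀ ∧ ∀ g : ℝ, 0 < g → g < g₀ →
      |criticalNu d g + 2 * greenZero d * g| ≤ ε * g := by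
  obtain ⟨g₀, hg₀, h⟩ := criticalNu_le_firstOrder hd hε
  refine ⟨g₀, hg₀, fun g hg hgg₀ => abs_le.2 ⟨?_, ?_⟩⟩
  · have := neg_two_greenZero_mul_le_criticalNu_of_three_le hd hg.le
    nlinarith [mul_pos hε hg]
  · have := h g hg hgg₀
    nlinarith

/-- **`ν_c(d, g) ∼ -2C₀(0) g` as `g ↓ 0`** (`d ≥ 3`): `ν_c(d,g)/g → -2C₀(0)`. [folklore] -/
theorem tendsto_criticalNu_div (hd : 3 ≤ d) :
    Tendsto (fun g : ℝ => criticalNu d g / g) (𝓝[>] 0) (𝓝 (-(2 * greenZero d))) := by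
  rw [Metric.tendsto_nhdsWithin_nhds]
  intro ε hε
  obtain ⟨g₀, hg₀, h⟩ := abs_criticalNu_add_le_firstOrder hd (half_pos hε)
  refine ⟨g₀, hg₀, fun g hg hdist => ?_⟩
  have hg' : 0 < g := hg
  rw [Real.dist_eq, sub_zero, abs_of_pos hg'] at hdist
  have hb := h g hg' hdist
  rw [Real.dist_eq, sub_neg_eq_add, div_add' _ _ _ hg'.ne', abs_div, abs_of_pos hg', div_lt_iff₀ hg']
  have := mul_pos hε hg'
  linarith

/-- **Theorem 1.2 to first order at `d = 4`** (`a = 2C₀(0)`): for every `ε > 0` there is `g₀ > 0`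
with `|ν_c(g) + ag| ≤ εg` for `g ∈ (0, g₀)` — the statement `BBS2015_thm12` with `Cg²` weakened to
`εg`, proved unconditionally. [cite: BauerschmidtBrydgesSlade2015LogCorr, Theorem 1.2 and Lemma A.1] -/
theorem BBS2015_thm12_firstOrder {ε : ℝ} (hε : 0 < ε) :
    ∃ g₀ : ℝ, 0 < g₀ ∧ ∀ g : ℝ, 0 < g → g < g₀ →
      |criticalNu 4 g + 2 * greenZero 4 * g| ≤ ε * g :=
  abs_criticalNu_add_le_firstOrder (by norm_num) hε

/-- At `d = 4`: `ν_c(g)/g → -a = -2C₀(0)` as `g ↓ 0`. [cite: BauerschmidtBrydgesSlade2015LogCorr, Theorem 1.2] -/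
theorem BBS2015_thm12_tendsto : Tendsto (fun g : ℝ => criticalNu 4 g / g) (𝓝[>] 0) (𝓝 (-(2 * greenZero 4))) :=
  tendsto_criticalNu_div (by norm_num)

/-! ### §1.3: `ν_c(0) = 0` and `ν_c(g) → 0` as `g ↓ 0` -/

/-- **`ν_c(d, 0) = 0`** (`d ≥ 1`): at `g = 0`, `c_T = 1` and `χ(0, ν) = ∫₀^∞ e^{-νT} dT` is finite
iff `ν > 0` ("`ν_c(0) = 0` is the critical point of the simple random walk", §1.3).
[cite: BauerschmidtBrydgesSlade2015LogCorr, §1.3 (first paragraph)] -/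
theorem criticalNu_zero_right (d : ℕ) : criticalNu d 0 = 0 := by
  have hset : {ν : ℝ | susceptibility d 0 ν < ∞} = Ioi 0 := by
    ext ν
    simp only [Set.mem_setOf_eq, Set.mem_Ioi]
    refine ⟨fun h => ?_, fun h => susceptibility_lt_top le_rfl d h⟩
    by_contra hν
    push Not at hν
    have htop : susceptibility d 0 ν = ∞ := by
      unfold susceptibility
      refine eq_top_iff.2 ?_
      calc (⊤ : ℝ≥0∞) = ∫⁻ _ in Ioi (0 : ℝ), 1 := by rw [setLIntegral_one, Real.volume_Ioi]
        _ ≤ ∫⁻ T in Ioi (0 : ℝ), survival d 0 T * ENNReal.ofReal (Real.exp (-ν * T)) := by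
            refine setLIntegral_mono' measurableSet_Ioi fun T hT => ?_
            rw [survival_zero_left d hT, one_mul, ← ENNReal.ofReal_one]
            exact ENNReal.ofReal_le_ofReal (Real.one_le_exp (by nlinarith [hT.out]))
    exact h.ne htop
  rw [criticalNu, hset, csInf_Ioi]

/-- **`ν_c(d, g) → 0` as `g ↓ 0`** (`d ≥ 3`; "`ν_c(g) → 0` as `g ↓ 0`, as expected since
`ν_c(0) = 0`", §1.3), from `-2C₀(0)g ≤ ν_c ≤ 0`.
[cite: BauerschmidtBrydgesSlade2015LogCorr, §1.3 (first paragraph)] -/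
theorem tendsto_criticalNu_zero (hd : 3 ≤ d) :
    Tendsto (fun g : ℝ => criticalNu d g) (𝓝[>] 0) (𝓝 0) := by
  have hlow : Tendsto (fun g : ℝ => -(2 * greenZero d * g)) (𝓝[>] 0) (𝓝 0) := by
    have h : Tendsto (fun g : ℝ => -(2 * greenZero d * g)) (𝓝 0) (𝓝 (-(2 * greenZero d * 0))) :=
      ((continuous_const.mul continuous_id).neg).tendsto 0
    rw [mul_zero, neg_zero] at h
    exact h.mono_left nhdsWithin_le_nhds
  refine tendsto_of_tendsto_of_tendsto_of_le_of_le' hlow tendsto_const_nhds ?_ ?_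
  · filter_upwards [self_mem_nhdsWithin] with g hg
    exact neg_two_greenZero_mul_le_criticalNu_of_three_le hd (le_of_lt hg)
  · filter_upwards [self_mem_nhdsWithin] with g hg
    exact criticalNu_le_zero (le_of_lt hg) d

/-! ### Monotonicity in the coupling: `ν_c(d, ·)` is non-increasing on `[0, ∞)` -/

/-- `∫ e^{-gI}` decreases with `g` (`I ≥ 0` on the sojourn simplex). [folklore] -/
theorem pathIntegral_antitone (T : ℝ) {x : Site d} (ω : (zdGraph d).Walk 0 x) :
    Antitone fun g : ℝ => pathIntegral g T ω := by
  intro g g' hgg'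
  unfold pathIntegral
  refine setLIntegral_mono' (measurableSet_sojournSet _ _) fun s hs => ENNReal.ofReal_le_ofReal ?_
  exact Real.exp_le_exp.2 (by nlinarith [selfIntersection_nonneg ω hs])

/-- `E₀[e^{-gI(T)} Φ(X(T))]` decreases with `g`. [folklore] -/
theorem weightedExpectation_antitone (d : ℕ) (T : ℝ) (Φ : Site d → ℝ≥0∞) :
    Antitone fun g : ℝ => weightedExpectation d g T Φ := by
  intro g g' h
  unfold weightedExpectation
  exact mul_le_mul' le_rfl (ENNReal.tsum_le_tsum fun k => Finset.sum_le_sum fun x _ =>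
    Finset.sum_le_sum fun ω _ => mul_le_mul' le_rfl (pathIntegral_antitone T ω h))

/-- `c_{g,T}` decreases with `g`. [folklore] -/
theorem survival_antitone (d : ℕ) (T : ℝ) : Antitone fun g : ℝ => survival d g T :=
  weightedExpectation_antitone d T _

/-- `χ(g, ν)` decreases with `g`. [folklore] -/
theorem susceptibility_antitone_coupling (d : ℕ) (ν : ℝ) :
    Antitone fun g : ℝ => susceptibility d g ν := by
  intro g g' h
  unfold susceptibility
  exact lintegral_mono fun T => mul_le_mul' (survival_antitone d T h) le_rfl

/-- **`ν_c(d, g)` is non-increasing in `g ≥ 0`** (`d ≥ 1`): a larger repulsion makes `c_{g,T}`, hence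
`χ(g, ν)`, smaller, so the set `{ν : χ(g,ν) < ∞}` grows. [folklore] -/
theorem criticalNu_antitoneOn (hd : 0 < d) : AntitoneOn (criticalNu d) (Ici 0) := by
  intro g hg g' hg' h
  show criticalNu d g' ≤ criticalNu d g
  unfold criticalNu
  refine csInf_le_csInf (bddBelow_susceptibility_lt_top hd hg') ⟨1, susceptibility_lt_top hg d one_pos⟩
    fun ν hν => ?_
  exact lt_of_le_of_lt (susceptibility_antitone_coupling d ν h) hν

end CTWSAW

end Literature.Barriers.CriticalPhenomena
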